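import Literature.NumberTheory.GaloisRepresentations.HasseArfCyclicProofs
import Literature.NumberTheory.GaloisRepresentations.RamificationGalois
import Literature.NumberTheory.GaloisRepresentations.CyclicNormIndex
import Literature.NumberTheory.GaloisRepresentations.ArtinConductorIntegralityProofs
import Mathlib.RingTheory.Trace.Basic
import Mathlib.RingTheory.DedekindDomain.IntegralClosure
import Mathlib.Algebra.CharP.Lemmas
import Mathlib.Data.ZMod.Basic
import Mathlib.FieldTheory.Finite.Basic
import Mathlib.RingTheory.Ideal.Over
import HarnessLib

/-!
# The cyclic totally ramified case of Hasse–Arf, IV: the inputs of Prop. V.11 in the Galois setting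

`HasseArfCyclicProofs.lean` proves Serre's Prop. V.11 (*Local Fields*, Ch. V §7) for an abstract
discrete valuation ring `S` with an action of a finite cyclic group `G = ⟨s⟩`, from explicit
inputs `hf1`, `he`, `htr`, `h90`, `hres`, `h10`, `h12`
(`HasseArfCyclic.exists_natCast_eq_herbrandPhi_of_cyclic`).  This file instantiates it in the
setting of the hypothesis `h11` of `hasseArf_of_cyclic` (`HasseArfReductionProofs.lean`): `R`
Dedekind with fraction field `K`, `L/K` finite Galois with cyclic group `G`, `S_L = integralClosure R L`,
a maximal ideal `𝔓` with separable residue extension and inertia group all of `G` — **under the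
extra assumption that `S_L` is a discrete valuation ring** (which holds after passage to the
completion, Serre II §3) — and discharges four of the inputs:

* `exists_smul_eq_self_and_sub_mem` (`hf1`, residue degree one): from `T_𝔓 = G` and the tree's
  `exists_inertia_fixed_sub_mem` (Serre I §7 Prop. 21 c));
* `exists_sum_smul_ne_zero` (`htr`): an integral element of non-zero trace (Mathlib
  `Algebra.trace_ne_zero`, denominators cleared by `IsLocalization.surj`);
* `exists_ne_zero_and_smul_eq_mul` (`h90`): Hilbert's Theorem 90 in ring form, from the tree's
  cyclic Hilbert 90 `CyclicNormIndex.exists_smul_div_eq_of_normEnd_eq_one`;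
* `exists_addVal_eq_card_mul` (`he`): `#G ∣ v(z)` for `s`-fixed `z ≠ 0`: `z ∈ R` (Galois
  invariants and integral closedness) and `v_𝔓 = e · v_𝔭` on `R` with `e = #T_𝔓 = #G`
  (`card_inertia_eq_ramificationIdxIn_of_isSeparable`, Mathlib
  `Ideal.IsDedekindDomain.emultiplicity_map_eq_ramificationIdx'_mul`);
* `exists_herbrandPsi_natCast_eq` — `ψ(n) ∈ ℕ` for `n ∈ ℕ` (Serre IV §3 Prop. 13 d)), so that the levels
  `U_L^{ψ(n)}` in Props. V.8–9 are integral (`⌈ψ(n+1)⌉₊ = ψ(n+1)` in `h12`);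
* `not_isAddCyclic_of_infinite`, `not_isAddCyclic_of_card_ne` — the hypothesis `hres` holds
  unless the residue field is the prime field `𝔽_p` (an additively cyclic field has `p` elements);
  `not_isAddCyclic_of_not_isAddCyclic_under` — and it may be checked on `R/𝔭`;
* `exists_natCast_eq_herbrandPhi_of_isDiscreteValuationRing` — **Prop. V.11 in the `h11`
  setting with `S_L` a DVR**, from the three remaining local inputs: `hres` (residue field not the
  prime field, Serre V §4), `h10` (Lemma V.10 ⇐ Prop. V.9 Cor. 1) and `h12` (Prop. V.8 with
  Cor. 3 to Prop. V.9), stated for `𝔓`.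

What is left for `hasseArf_holds`: the passage from the Dedekind setting of `h11` to the
completion at `𝔓` (Serre II §3 Thm 1, IV §1 Remark 2), and the norm computations `h10`, `h12`
(Serre V §§1–6) together with the residue-field extension removing `hres` (V §4).

## References

* J.-P. Serre, *Local Fields*, GTM 67, Springer 1979, Ch. I §7 Prop. 21; Ch. V §4, §6 (Props.
  8–9, Cor. 1, 3), §7 (Prop. 11, Lemmas 8–13). [SerreLocalFields1979]
* J. Neukirch, *Algebraic Number Theory*, Springer 1999, Ch. IV §3 Thm. (3.5) (Hilbert 90).
  [NeukirchANT1999]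
-/

noncomputable section

open IsLocalRing IsDiscreteValuationRing
open scoped Pointwise nonZeroDivisors

namespace Literature.NumberTheory.GaloisRepresentations

namespace HasseArfCyclic

/-- An element fixed by a generator of a cyclic group is fixed by the group. [folklore] -/
theorem smul_eq_self_of_generator {G α : Type*} [Group G] [MulAction G α] (s : G)
    (hs : ∀ g : G, g ∈ Subgroup.zpowers s) {z : α} (hz : s • z = z) (g : G) : g • z = z := by
  obtain ⟨k, rfl⟩ := Subgroup.mem_zpowers_iff.mp (hs g)
  induction k using Int.induction_on with
  | zero => simp
  | succ n ih => rw [zpow_add_one, mul_smul, hz, ih]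
  | pred n ih =>
    rw [zpow_sub_one, mul_smul]
    have : s⁻¹ • z = z := by
      conv_lhs => rw [← hz]
      rw [inv_smul_smul]
    rw [this, ih]

/-- In a DVR, `addVal` is the multiplicity of the maximal ideal in the principal ideal. [folklore] -/
theorem addVal_eq_emultiplicity {S : Type*} [CommRing S] [IsDomain S] [IsDiscreteValuationRing S]
    (z : S) : addVal S z = emultiplicity (maximalIdeal S) (Ideal.span {z}) := by
  refine le_antisymm ?_ ?_ <;> refine ENat.forall_natCast_le_iff_le.mp fun n hn => ?_
  · rw [← mem_maximalIdeal_pow_iff_le_addVal] at hn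
    rw [← pow_dvd_iff_le_emultiplicity, Ideal.dvd_span_singleton]
    exact hn
  · rw [← pow_dvd_iff_le_emultiplicity, Ideal.dvd_span_singleton] at hn
    rw [← mem_maximalIdeal_pow_iff_le_addVal]
    exact hn

/-! ### `ψ(ℕ) ⊆ ℕ` (Serre IV §3 Prop. 13 d)), needed to read `U_L^{ψ(n)}` in `h10`, `h12` -/

section PsiNat

variable {S : Type*} [CommRing S] (𝔓 : Ideal S) (G : Type*) [Group G] [MulSemiringAction G S]

/-- **`ψ` takes integral values at integers** (Serre IV §3 Prop. 13 d)): for `n ∈ ℕ`,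
`ψ(n) = m ∈ ℕ`.  With `u = ψ(n)`, `m = ⌊u⌋`: `g₀ n = g₁ + ⋯ + g_m + (u - m) g_{m+1}` and `g_{m+1}`
divides `g₀, …, g_m`, so `u - m ∈ ℤ ∩ [0, 1)`, i.e. `u = m`.
Ref: Serre, *Local Fields*, Ch. IV §3, Prop. 13 d) (p. 73). [cite: SerreLocalFields1979, Ch. IV §3 Prop. 13 d) (p. 73)] -/
theorem exists_herbrandPsi_natCast_eq [Finite G] (n : ℕ) : ∃ m : ℕ, herbrandPsi 𝔓 G n = m := by
  set u : ℝ := herbrandPsi 𝔓 G n with hu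
  have hφu : herbrandPhi 𝔓 G u = n := herbrandPhi_herbrandPsi_holds 𝔓 G n
  have hu0 : 0 ≤ u := by
    rw [← herbrandPhi_nonneg_iff 𝔓 G, hφu]
    exact Nat.cast_nonneg n
  set m : ℕ := ⌊u⌋₊ with hm
  have hmu : (m : ℝ) ≤ u := Nat.floor_le hu0
  have hum : u < m + 1 := Nat.lt_floor_add_one u
  refine ⟨m, ?_⟩
  -- notation for the orders `g i = #G_i`
  set g : ℕ → ℕ := fun i => Nat.card (𝔓.ramificationSubgroup G i) with hg
  have hgpos : ∀ i, 0 < g i := fun i => Nat.card_pos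
  have hdvd : ∀ {i j : ℕ}, i ≤ j → g j ∣ g i := fun {i j} hij =>
    Subgroup.card_dvd_of_le (𝔓.ramificationSubgroup_antitone G hij)
  -- `g₀ φ(m) = Σ_{i<m} g_{i+1}` and `φ(u) = φ(m) + (u - m) g_{m+1}/g₀`
  have hφm : (g 0 : ℝ) * herbrandPhi 𝔓 G m = ∑ i ∈ Finset.range m, (g (i + 1) : ℝ) := by
    rw [herbrandPhi_natCast, Finset.mul_sum]
    refine Finset.sum_congr rfl fun i _ => ?_
    rw [mul_div_cancel₀ _ (Nat.cast_pos.mpr (hgpos 0)).ne']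
  have hφu' : herbrandPhi 𝔓 G u = herbrandPhi 𝔓 G m + (u - m) * ((g (m + 1) : ℝ) / g 0) :=
    herbrandPhi_eq_of_mem_Icc 𝔓 G m ⟨hmu, hum.le⟩
  -- the divisibility: `Σ_{i<m} g_{i+1} = g_{m+1} a`, `g₀ = g_{m+1} b`
  obtain ⟨a, ha⟩ : g (m + 1) ∣ ∑ i ∈ Finset.range m, g (i + 1) :=
    Finset.dvd_sum fun i hi => hdvd (by have := Finset.mem_range.mp hi; omega)
  obtain ⟨b, hb⟩ : g (m + 1) ∣ g 0 := hdvd (Nat.zero_le _)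
  -- `(u - m) g_{m+1} = g_{m+1} (b n - a)`, so `u - m = b n - a ∈ ℤ`
  have hgm : (0 : ℝ) < g (m + 1) := Nat.cast_pos.mpr (hgpos _)
  have hg0 : (0 : ℝ) < g 0 := Nat.cast_pos.mpr (hgpos 0)
  have key : u - m = (b : ℝ) * n - a := by
    have h1 : (g 0 : ℝ) * n = (g 0 : ℝ) * herbrandPhi 𝔓 G m + (u - m) * g (m + 1) := by
      rw [← hφu, hφu', mul_add]
      congr 1
      field_simp
    rw [hφm] at h1
    have h2 : (∑ i ∈ Finset.range m, (g (i + 1) : ℝ)) = (g (m + 1) : ℝ) * a := by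
      exact_mod_cast ha
    have h3 : (g 0 : ℝ) = (g (m + 1) : ℝ) * b := by exact_mod_cast hb
    rw [h2, h3] at h1
    -- h1 : g_{m+1} b n = g_{m+1} a + (u - m) g_{m+1}
    have h4 : (g (m + 1) : ℝ) * ((u - m) - (b * n - a)) = 0 := by linear_combination -h1
    rcases mul_eq_zero.mp h4 with h | h
    · exact absurd h hgm.ne'
    · linarith
  -- an integer in `[0, 1)` is `0`
  have hint : ∃ k : ℤ, u - m = k := ⟨b * n - a, by rw [key]; push_cast; ring⟩
  obtain ⟨k, hk⟩ := hint
  have hk0 : (0 : ℝ) ≤ k := by rw [← hk]; linarith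
  have hk1 : (k : ℝ) < 1 := by rw [← hk]; linarith
  have : k = 0 := by
    have h0 : 0 ≤ k := by exact_mod_cast hk0
    have h1 : k < 1 := by exact_mod_cast hk1
    omega
  rw [this, Int.cast_zero, sub_eq_zero] at hk
  exact hk

end PsiNat

/-! ### The hypothesis `hres`: a field is additively cyclic only if it is the prime field -/

/-- An additively cyclic field has positive characteristic `p` and exactly `p` elements (it is the
prime field `𝔽_p`). [folklore] -/
theorem ringChar_ne_zero_and_card_eq_of_isAddCyclic (F : Type*) [Field F] [h : IsAddCyclic F] :
    ringChar F ≠ 0 ∧ Nat.card F = ringChar F := by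
  obtain ⟨g, hg⟩ := h.exists_zsmul_surjective
  have hg0 : g ≠ 0 := by
    rintro rfl
    obtain ⟨n, hn⟩ := hg 1
    simp at hn
  obtain ⟨p, hp⟩ := CharP.exists F
  have hpc : ringChar F = p := ringChar.eq F p
  rcases CharP.char_is_prime_or_zero F p with hprime | rfl
  · -- positive characteristic: `F` is a quotient of `ℤ/p` as an additive group, and contains it
    haveI : Fact p.Prime := ⟨hprime⟩
    let ι : ZMod p →+* F := ZMod.castHom (dvd_refl p) F
    have hsurj : Function.Surjective fun k : ZMod p => ι k * g := by
      intro x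
      obtain ⟨n, rfl⟩ := hg x
      refine ⟨(n : ZMod p), ?_⟩
      simp only [ι, map_intCast, zsmul_eq_mul]
    have hinj : Function.Injective ι := ι.injective
    haveI : Finite F := Finite.of_surjective _ hsurj
    refine ⟨by rw [hpc]; exact hprime.ne_zero, ?_⟩
    rw [hpc]
    refine le_antisymm ?_ ?_
    · simpa using Nat.card_le_card_of_surjective _ hsurj
    · simpa using Nat.card_le_card_of_injective _ hinj
  · -- characteristic zero is impossible: `g/2 = n g` forces `g = 0`
    haveI : CharZero F := CharP.charP_to_charZero F
    exfalso
    obtain ⟨n, hn⟩ := hg (g / 2)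
    simp only [zsmul_eq_mul] at hn
    have h2 : (2 * (n : F) - 1) * g = 0 := by
      have : (n : F) * g * 2 = g := by rw [hn, div_mul_cancel₀ g two_ne_zero]
      linear_combination this
    rcases mul_eq_zero.mp h2 with h | h
    · have h' : ((2 * n - 1 : ℤ) : F) = 0 := by push_cast; exact h
      rw [Int.cast_eq_zero] at h'
      omega
    · exact hg0 h

/-- An infinite field is not additively cyclic. [folklore] -/
theorem not_isAddCyclic_of_infinite (F : Type*) [Field F] [Infinite F] : ¬ IsAddCyclic F := by
  intro h
  have := (ringChar_ne_zero_and_card_eq_of_isAddCyclic F).2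
  rw [Nat.card_eq_zero_of_infinite] at this
  exact (ringChar_ne_zero_and_card_eq_of_isAddCyclic F).1 this.symm

/-- A finite field whose cardinality is not its characteristic (i.e. not the prime field) is not
additively cyclic. [folklore] -/
theorem not_isAddCyclic_of_card_ne (F : Type*) [Field F] (h : Nat.card F ≠ ringChar F) :
    ¬ IsAddCyclic F := fun _ =>
  h (ringChar_ne_zero_and_card_eq_of_isAddCyclic F).2

/-- If the residue field `S/𝔓` of an extension is additively cyclic, so is the residue field
`R/𝔭` below it (it embeds additively).  Contrapositive: `hres` for `S/𝔓` follows from `hres` for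
`R/𝔭`. [folklore] -/
theorem not_isAddCyclic_of_not_isAddCyclic_under {R S : Type*} [CommRing R] [CommRing S]
    [Algebra R S] (𝔭 : Ideal R) [𝔭.IsMaximal] (𝔓 : Ideal S) [𝔓.IsMaximal] [𝔓.LiesOver 𝔭]
    (h : ¬ IsAddCyclic (R ⧸ 𝔭)) : ¬ IsAddCyclic (S ⧸ 𝔓) := by
  intro hS
  letI : Field (R ⧸ 𝔭) := Ideal.Quotient.field 𝔭
  letI : Field (S ⧸ 𝔓) := Ideal.Quotient.field 𝔓
  exact h (isAddCyclic_of_injective (algebraMap (R ⧸ 𝔭) (S ⧸ 𝔓)).toAddMonoidHom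
    (algebraMap (R ⧸ 𝔭) (S ⧸ 𝔓)).injective)

/-! ### The inputs `hf1`, `htr`, `h90`, `he` for `S_L = integralClosure R L` -/

variable {R : Type*} {K L : Type*} [CommRing R] [Field K] [Field L] [Algebra R K] [Algebra R L]
  [Algebra K L] [IsScalarTower R K L]

/-- **Residue degree one** (`hf1`): if the inertia group of `𝔓` is all of `Gal(L/K)` and the
residue extension is separable, every residue class of `S_L` modulo `𝔓` contains an element
fixed by any given `s ∈ Gal(L/K)` (tree: `exists_inertia_fixed_sub_mem`, Serre I §7 Prop. 21 c)).
[cite: SerreLocalFields1979, Ch. I §7 Prop. 21 c) and Cor.] -/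
theorem exists_smul_eq_self_and_sub_mem [FiniteDimensional K L]
    (𝔓 : Ideal (integralClosure R L)) [𝔓.IsMaximal]
    [Algebra.IsSeparable (R ⧸ 𝔓.under R) (integralClosure R L ⧸ 𝔓)]
    (htot : 𝔓.inertia (L ≃ₐ[K] L) = ⊤) (s : L ≃ₐ[K] L) (q : integralClosure R L) :
    ∃ a : integralClosure R L, s • a = a ∧ a - q ∈ 𝔓 := by
  haveI : (𝔓.under R).IsMaximal := Ideal.IsMaximal.under R 𝔓
  haveI : 𝔓.LiesOver (𝔓.under R) := ⟨rfl⟩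
  obtain ⟨b₀, hfix, hb⟩ := exists_inertia_fixed_sub_mem (L ≃ₐ[K] L) (𝔓.under R) 𝔓 q
  refine ⟨b₀, hfix s (htot ▸ Subgroup.mem_top s), ?_⟩
  rw [← neg_sub]
  exact 𝔓.neg_mem hb

/-- **An integral element of non-zero trace** (`htr`), for `L/K` finite Galois (separable):
`∑ g, g • t ≠ 0` for some `t ∈ S_L` (Mathlib `Algebra.trace_ne_zero`, cleared denominators).
[folklore] -/
theorem exists_sum_smul_ne_zero [IsDomain R] [IsFractionRing R K] [FiniteDimensional K L]
    [IsGalois K L] :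
    ∃ t : integralClosure R L, ∑ g : L ≃ₐ[K] L, g • t ≠ 0 := by
  classical
  obtain ⟨l, hl⟩ : ∃ l : L, Algebra.trace K L l ≠ 0 := by
    by_contra h
    push Not at h
    exact Algebra.trace_ne_zero K L (LinearMap.ext h)
  haveI := IsIntegralClosure.isLocalization R K L (integralClosure R L)
  obtain ⟨⟨t, d⟩, htd⟩ :=
    IsLocalization.surj (Algebra.algebraMapSubmonoid (integralClosure R L) R⁰) l
  obtain ⟨d₀, hd₀, hd⟩ := d.2
  refine ⟨t, fun hsum => hl ?_⟩
  -- `trace t = 0`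
  have h1 : Algebra.trace K L (t : L) = 0 := by
    apply (algebraMap K L).injective
    rw [trace_eq_sum_automorphisms, map_zero]
    have := congrArg (fun z : integralClosure R L => (z : L)) hsum
    simpa [integralClosure.coe_smul, AlgEquiv.smul_def] using this
  -- `t = l · d₀`
  have h2 : (t : L) = algebraMap R K d₀ • l := by
    have : (t : L) = l * algebraMap (integralClosure R L) L d := htd.symm
    rw [this, ← hd, Algebra.smul_def, mul_comm,
      ← IsScalarTower.algebraMap_apply R (integralClosure R L) L,
      ← IsScalarTower.algebraMap_apply R K L]
  rw [h2, LinearMap.map_smul, smul_eq_zero] at h1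
  rcases h1 with h1 | h1
  · exact absurd h1 ((map_ne_zero_iff _ (IsFractionRing.injective R K)).mpr
      (nonZeroDivisors.ne_zero hd₀))
  · exact h1

/-- **Hilbert's Theorem 90 in ring form** (`h90`): for `L/K` finite Galois with cyclic group
generated by `s`, an element `x ∈ S_L` of norm `∏ g, g • x = 1` satisfies `s(y) = x y` for some
`y ∈ S_L ∖ 0` (tree: `CyclicNormIndex.exists_smul_div_eq_of_normEnd_eq_one`, denominators cleared).
[cite: NeukirchANT1999, Ch. IV §3 Thm. (3.5)] -/
theorem exists_ne_zero_and_smul_eq_mul [IsDomain R] [IsFractionRing R K] [FiniteDimensional K L]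
    [IsGalois K L] (s : L ≃ₐ[K] L) (hs : ∀ g : L ≃ₐ[K] L, g ∈ Subgroup.zpowers s)
    (x : integralClosure R L) (hx : ∏ g : L ≃ₐ[K] L, g • x = 1) :
    ∃ y : integralClosure R L, y ≠ 0 ∧ s • y = x * y := by
  classical
  have hprod : ∏ g : L ≃ₐ[K] L, g (x : L) = 1 := by
    have := congrArg (fun z : integralClosure R L => (z : L)) hx
    simpa [integralClosure.coe_smul, AlgEquiv.smul_def] using this
  have hx0 : (x : L) ≠ 0 := by
    intro h
    have h1 : ∏ g : L ≃ₐ[K] L, g (x : L) = 0 :=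
      Finset.prod_eq_zero (Finset.mem_univ 1) (by rw [h, map_zero])
    rw [hprod] at h1
    exact one_ne_zero h1
  set a : Lˣ := Units.mk0 (x : L) hx0 with ha_def
  have ha : CyclicNormIndex.normEnd s (Nat.card (L ≃ₐ[K] L)) a = 1 := by
    ext
    rw [CyclicNormIndex.coe_normEnd_eq_algebraMap_norm hs, Units.val_one,
      Algebra.norm_eq_prod_automorphisms, ha_def, Units.val_mk0, hprod]
  obtain ⟨b, hb⟩ := CyclicNormIndex.exists_smul_div_eq_of_normEnd_eq_one hs ha
  have hb' : s (b : L) = (x : L) * b := by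
    have := congrArg (fun u : Lˣ => (u : L)) hb
    simp only [Units.val_div_eq_div_val, CyclicNormIndex.coe_smul_units, ha_def,
      Units.val_mk0] at this
    rwa [div_eq_iff b.ne_zero] at this
  haveI := IsIntegralClosure.isLocalization R K L (integralClosure R L)
  obtain ⟨⟨y, d⟩, hyd⟩ :=
    IsLocalization.surj (Algebra.algebraMapSubmonoid (integralClosure R L) R⁰) (b : L)
  obtain ⟨d₀, hd₀, hd⟩ := d.2
  have hdL : algebraMap (integralClosure R L) L d = algebraMap K L (algebraMap R K d₀) := by
    rw [← hd, ← IsScalarTower.algebraMap_apply, ← IsScalarTower.algebraMap_apply]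
  have hd0 : algebraMap (integralClosure R L) L d ≠ 0 := by
    rw [hdL, Ne, map_eq_zero_iff _ (algebraMap K L).injective,
      map_eq_zero_iff _ (IsFractionRing.injective R K)]
    exact nonZeroDivisors.ne_zero hd₀
  refine ⟨y, ?_, ?_⟩
  · intro hy
    rw [hy, map_zero, mul_eq_zero] at hyd
    rcases hyd with h | h
    · exact b.ne_zero h
    · exact hd0 h
  · apply Subtype.ext
    have hy : (y : L) = (b : L) * algebraMap (integralClosure R L) L d := hyd.symm
    rw [integralClosure.coe_smul, AlgEquiv.smul_def, MulMemClass.coe_mul, hy, map_mul, hb', hdL,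
      AlgEquiv.commutes, mul_assoc]

/-- **Total ramification gives `#G ∣ v(z)` for fixed `z`** (`he`): for `L/K` finite Galois with
cyclic group `⟨s⟩`, `S_L = integralClosure R L` a discrete valuation ring (`R` Dedekind) whose
maximal ideal `𝔓` has inertia group all of `G` and separable residue extension, an `s`-fixed
`z ≠ 0` of `S_L` has valuation divisible by `#G`: `z` comes from `R`, and
`v_𝔓 = e · v_𝔭` on `R` with `e = #T_𝔓 = #G` (Serre I §7 Prop. 21; Mathlib
`Ideal.IsDedekindDomain.emultiplicity_map_eq_ramificationIdx'_mul`).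
[cite: SerreLocalFields1979, Ch. I §7 Cor. to Prop. 21] -/
theorem exists_addVal_eq_card_mul [IsDedekindDomain R] [IsFractionRing R K]
    [FiniteDimensional K L] [IsGalois K L] [IsDiscreteValuationRing (integralClosure R L)]
    (𝔓 : Ideal (integralClosure R L)) [𝔓.IsMaximal]
    [Algebra.IsSeparable (R ⧸ 𝔓.under R) (integralClosure R L ⧸ 𝔓)]
    (htot : 𝔓.inertia (L ≃ₐ[K] L) = ⊤) (s : L ≃ₐ[K] L)
    (hs : ∀ g : L ≃ₐ[K] L, g ∈ Subgroup.zpowers s)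
    (z : integralClosure R L) (hz0 : z ≠ 0) (hsz : s • z = z) :
    ∃ q : ℕ, addVal (integralClosure R L) z = (Nat.card (L ≃ₐ[K] L) * q : ℕ) := by
  classical
  haveI : IsDedekindDomain (integralClosure R L) := integralClosure.isDedekindDomain R K L
  haveI : IsFractionRing (integralClosure R L) L :=
    integralClosure.isFractionRing_of_finite_extension K L
  haveI : Module.Finite R (integralClosure R L) :=
    IsIntegralClosure.finite R K L (integralClosure R L)
  haveI : IsGaloisGroup (L ≃ₐ[K] L) R (integralClosure R L) :=
    IsGaloisGroup.of_isFractionRing _ R (integralClosure R L) K L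
  haveI : FaithfulSMul R (integralClosure R L) := by
    rw [faithfulSMul_iff_algebraMap_injective]
    intro a b h
    have h' : algebraMap R L a = algebraMap R L b := by
      rw [IsScalarTower.algebraMap_apply R (integralClosure R L) L,
        IsScalarTower.algebraMap_apply R (integralClosure R L) L, h]
    rw [IsScalarTower.algebraMap_apply R K L, IsScalarTower.algebraMap_apply R K L] at h'
    exact IsFractionRing.injective R K ((algebraMap K L).injective h')
  haveI : Module.IsTorsionFree R (integralClosure R L) := by
    rw [Module.isTorsionFree_iff_faithfulSMul]
    infer_instance
  -- `z` comes from `R`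
  have hfix : ∀ g : L ≃ₐ[K] L, g • z = z := smul_eq_self_of_generator s hs hsz
  obtain ⟨k, hk⟩ : ∃ k : K, algebraMap K L k = (z : L) := by
    have hmem : (z : L) ∈ (⊥ : IntermediateField K L) :=
      (IsGalois.mem_bot_iff_fixed (z : L)).mpr fun g => by
        have := congrArg Subtype.val (hfix g)
        simpa [integralClosure.coe_smul, AlgEquiv.smul_def] using this
    exact IntermediateField.mem_bot.mp hmem
  have hkint : IsIntegral R k := by
    have hzint : IsIntegral R (z : L) := z.2
    rw [← hk] at hzint
    exact (isIntegral_algHom_iff (IsScalarTower.toAlgHom R K L) (algebraMap K L).injective).mp hzint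
  obtain ⟨r, hr⟩ : ∃ r : R, algebraMap R K r = k := IsIntegrallyClosed.isIntegral_iff.mp hkint
  have hzr : z = algebraMap R (integralClosure R L) r := by
    apply Subtype.ext
    change (z : L) = algebraMap R L r
    rw [← hk, ← hr, ← IsScalarTower.algebraMap_apply]
  have hr0 : r ≠ 0 := by
    rintro rfl
    exact hz0 (by rw [hzr, map_zero])
  -- the primes
  have h𝔓 : 𝔓 = maximalIdeal (integralClosure R L) := IsLocalRing.eq_maximalIdeal inferInstance
  have h𝔓0 : 𝔓 ≠ ⊥ := by
    rw [h𝔓]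
    exact IsDiscreteValuationRing.not_a_field _
  have h𝔭0 : 𝔓.under R ≠ ⊥ := mt Ideal.eq_bot_of_comap_eq_bot h𝔓0
  haveI : (𝔓.under R).IsMaximal := Ideal.IsMaximal.under R 𝔓
  haveI : 𝔓.LiesOver (𝔓.under R) := ⟨rfl⟩
  have hirr𝔭 : Irreducible (𝔓.under R) := (Ideal.prime_of_isPrime h𝔭0 inferInstance).irreducible
  have hirr𝔓 : Irreducible 𝔓 := (Ideal.prime_of_isPrime h𝔓0 inferInstance).irreducible
  -- `e = #G`
  have he : (𝔓.under R).ramificationIdx' 𝔓 = Nat.card (L ≃ₐ[K] L) := by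
    rw [Ideal.ramificationIdx'_eq_ramificationIdx _ 𝔓 h𝔭0,
      ← Ideal.ramificationIdxIn_eq_ramificationIdx (𝔓.under R) 𝔓 (L ≃ₐ[K] L),
      ← card_inertia_eq_ramificationIdxIn_of_isSeparable (G := L ≃ₐ[K] L) (𝔓.under R) 𝔓,
      htot, Subgroup.card_top]
  -- multiplicities
  have hspan0 : Ideal.span {r} ≠ ⊥ := by
    rwa [Ne, Ideal.span_singleton_eq_bot]
  have hmult := Ideal.IsDedekindDomain.emultiplicity_map_eq_ramificationIdx'_mul
    (S := integralClosure R L) hspan0 hirr𝔭 hirr𝔓 h𝔓0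
  have hfin : emultiplicity (𝔓.under R) (Ideal.span {r}) =
      multiplicity (𝔓.under R) (Ideal.span {r}) :=
    (FiniteMultiplicity.of_prime_left (Ideal.prime_of_isPrime h𝔭0 inferInstance)
      hspan0).emultiplicity_eq_multiplicity
  refine ⟨multiplicity (𝔓.under R) (Ideal.span {r}), ?_⟩
  rw [addVal_eq_emultiplicity, ← h𝔓, hzr, show Ideal.span {algebraMap R (integralClosure R L) r} =
      (Ideal.span {r}).map (algebraMap R (integralClosure R L)) by
    rw [Ideal.map_span, Set.image_singleton], hmult, he, hfin]
  norm_cast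


/-- **Serre's Prop. V.11 in the setting of `h11` when `S_L` is a discrete valuation ring**, from
the local inputs `hres`, `h10`, `h12`.  `R` Dedekind with fraction field `K`, `L/K` finite
Galois with cyclic group `G`, `S_L = integralClosure R L` a DVR, `𝔓` its maximal ideal with
separable residue extension and `T_𝔓 = G`; `hres`: `S_L/𝔓` is not the prime field (not
additively cyclic); `h10`: for `m ≥ 1` with `φ(m) ∈ ℕ` and `G_m = G_{m+1}`, a norm-one
`x ≡ 1 mod 𝔓ᵐ` is `≡ 1 mod 𝔓ᵐ⁺¹` (Serre's Lemma V.10, from Prop. V.9 Cor. 1); `h12`: for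
`m ≥ 1`, `n < φ(m)` and `G_{⌈ψ(n+1)⌉} = 1`, every `x ≡ 1 mod 𝔓ᵐ` has the norm of some
`y ≡ 1 mod 𝔓^{⌈ψ(n+1)⌉}` (Prop. V.8 with Cor. 3 to Prop. V.9).  Conclusion: if
`G_μ ≠ 1 = G_{μ+1}` then `φ(μ) ∈ ℕ` — by `exists_natCast_eq_herbrandPhi_of_cyclic` with the
inputs `hf1`, `he`, `htr`, `h90` supplied by this file.
Ref: Serre, *Local Fields*, Ch. V §7, Prop. 11 (pp. 93–96).
[cite: SerreLocalFields1979, Ch. V §7 Prop. 11 (proof, pp. 93–96)] -/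
theorem exists_natCast_eq_herbrandPhi_of_isDiscreteValuationRing [IsDedekindDomain R]
    [IsFractionRing R K] [FiniteDimensional K L] [IsGalois K L]
    [IsDiscreteValuationRing (integralClosure R L)]
    (𝔓 : Ideal (integralClosure R L)) [𝔓.IsMaximal]
    [Algebra.IsSeparable (R ⧸ 𝔓.under R) (integralClosure R L ⧸ 𝔓)]
    (hcyc : IsCyclic (L ≃ₐ[K] L)) (htot : 𝔓.inertia (L ≃ₐ[K] L) = ⊤)
    (hres : ¬ IsAddCyclic (integralClosure R L ⧸ 𝔓))
    (h10 : ∀ m : ℕ, 1 ≤ m → (∃ n : ℕ, herbrandPhi 𝔓 (L ≃ₐ[K] L) m = n) →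
      𝔓.ramificationSubgroup (L ≃ₐ[K] L) m = 𝔓.ramificationSubgroup (L ≃ₐ[K] L) (m + 1) →
      ∀ x : integralClosure R L, x - 1 ∈ 𝔓 ^ m → ∏ g : L ≃ₐ[K] L, g • x = 1 →
        x - 1 ∈ 𝔓 ^ (m + 1))
    (h12 : ∀ n m : ℕ, 1 ≤ m → (n : ℝ) < herbrandPhi 𝔓 (L ≃ₐ[K] L) m →
      𝔓.ramificationSubgroup (L ≃ₐ[K] L) ⌈herbrandPsi 𝔓 (L ≃ₐ[K] L) (n + 1)⌉₊ = ⊥ →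
      ∀ x : integralClosure R L, x - 1 ∈ 𝔓 ^ m → ∃ y : integralClosure R L,
        y - 1 ∈ 𝔓 ^ ⌈herbrandPsi 𝔓 (L ≃ₐ[K] L) (n + 1)⌉₊ ∧
        ∏ g : L ≃ₐ[K] L, g • y = ∏ g : L ≃ₐ[K] L, g • x)
    {μ : ℕ} (hμ : 𝔓.ramificationSubgroup (L ≃ₐ[K] L) μ ≠ ⊥)
    (hμ1 : 𝔓.ramificationSubgroup (L ≃ₐ[K] L) (μ + 1) = ⊥) :
    ∃ n : ℕ, (n : ℝ) = herbrandPhi 𝔓 (L ≃ₐ[K] L) μ := by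
  classical
  have h𝔓 : 𝔓 = maximalIdeal (integralClosure R L) := IsLocalRing.eq_maximalIdeal inferInstance
  subst h𝔓
  haveI := hcyc
  obtain ⟨s, hs⟩ := IsCyclic.exists_generator (α := L ≃ₐ[K] L)
  exact exists_natCast_eq_herbrandPhi_of_cyclic s hs (exists_smul_eq_self_and_sub_mem _ htot s)
    (exists_addVal_eq_card_mul _ htot s hs) exists_sum_smul_ne_zero
    (exists_ne_zero_and_smul_eq_mul s hs) hres h10 h12 hμ hμ1

end HasseArfCyclic

end Literature.NumberTheory.GaloisRepresentations

end
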